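import Summits.BirchSwinnertonDyer.BirchSwinnertonDyer.Theorems.CyclotomicUntwistGNineConverseCubic
import Summits.BirchSwinnertonDyer.BirchSwinnertonDyer.Theorems.CyclotomicUntwistGNineConverseNine
import HarnessLib

/-!
# Converse of `GNineCriterion`: Newton iteration for a monic cubic, residues modulo `(ζ₉ − 1)`

Support file for the crux `PSRankOneLowerHalfAtThree` (K1) of the route `CyclotomicUntwist`
(sub-problem `BirchSwinnertonDyer`), part of the converse of `GNineCriterion`.  Generic
valuation-theoretic tools used to extract an approximate root of the `2`-cleared cubic of an
elliptic curve with good reduction over `ℚ(ζ₉)`: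

* `newton_step`, `newton_iter` — Newton's iteration for a monic cubic `f = X³ + αX² + βX + γ` with
  integral coefficients over a valued field: from `v(f(x)) < 1 = v(f′(x))` one reaches
  `v(f(y)) ≤ v(f(x))^{2ⁿ}` keeping `v(f′(y)) = 1` (no completeness needed);
* `val_le_one_of_val_eval_le_one` — an element at which a monic integral cubic is integral is
  itself integral; `val_eval_sub_le_val_sub` — `v(f(z) − f(X)) ≤ v(z − X)` for integral `z, X`;
* `exists_simple_root_mod_three` — a monic cubic over `𝔽₃` with discriminant `≡ 2` (a
  non-square) has a simple root in `𝔽₃` (its factorisation type is `(1)(2)`); by enumeration;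
* `exists_int_residue` — every element of `𝓞 F`, `F ⊇ ℚ(ζ₉)`-type cyclotomic, is congruent to
  `0, 1` or `2` modulo the prime `w ∋ 3` (residue field `𝔽₃`).

References: J. Neukirch, *Algebraic Number Theory*, II (4.6) (Hensel–Newton); L. Washington,
*Cyclotomic Fields*, Lemma 1.4.
-/

set_option linter.dupNamespace false

open scoped NumberField

open IsDedekindDomain IsDedekindDomain.HeightOneSpectrum NumberField Literature.NumberTheory.LFunctions

namespace Summit.BirchSwinnertonDyer.BirchSwinnertonDyer.Theorems.GNineConverse

section Generic

variable {K : Type*} [Field K] {Γ₀ : Type*} [LinearOrderedCommGroupWithZero Γ₀] (v : Valuation K Γ₀)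

/-! ### Integrality -/

variable {v}

/-- **Integrality from an integral value.** If `X³ + AX² + BX + C` is integral at `X` and
`A, B, C` are integral, then `X` is integral: otherwise `v(f(X)) = v(X)³ > 1`. [folklore] -/
theorem val_le_one_of_val_eval_le_one {A B C X : K} (hA : v A ≤ 1) (hB : v B ≤ 1) (hC : v C ≤ 1)
    (h : v (X ^ 3 + A * X ^ 2 + B * X + C) ≤ 1) : v X ≤ 1 := by
  by_contra hX
  rw [not_le] at hX
  have hX0 : 0 < v X := lt_trans zero_lt_one hX
  have h12 : v X < v X ^ 2 := by
    rw [pow_two]; exact lt_mul_of_one_lt_left hX0 hX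
  have h23 : v X ^ 2 < v X ^ 3 := by
    rw [show v X ^ 3 = v X ^ 2 * v X from pow_succ (v X) 2]
    exact lt_mul_of_one_lt_right (pow_pos hX0 2) hX
  have h1 : v (A * X ^ 2) < v (X ^ 3) := by
    rw [Valuation.map_mul, Valuation.map_pow, Valuation.map_pow]
    exact lt_of_le_of_lt (mul_le_of_le_one_left zero_le hA) h23
  have h2 : v (B * X) < v (X ^ 3 + A * X ^ 2) := by
    rw [v.map_add_eq_of_lt_left h1, Valuation.map_mul, Valuation.map_pow]
    exact lt_of_le_of_lt (mul_le_of_le_one_left zero_le hB) (h12.trans h23)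
  have h3 : v C < v (X ^ 3 + A * X ^ 2 + B * X) := by
    rw [v.map_add_eq_of_lt_left h2, v.map_add_eq_of_lt_left h1, Valuation.map_pow]
    exact lt_of_le_of_lt hC ((hX.trans h12).trans h23)
  have hval : v (X ^ 3 + A * X ^ 2 + B * X + C) = v X ^ 3 := by
    rw [v.map_add_eq_of_lt_left h3, v.map_add_eq_of_lt_left h2, v.map_add_eq_of_lt_left h1,
      Valuation.map_pow]
  rw [hval] at h
  exact absurd (lt_of_lt_of_le ((hX.trans h12).trans h23) h) (lt_irrefl _)

/-- `v(f(z) − f(X)) ≤ v(z − X)` for integral `A, B, X, z`. [folklore] -/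
theorem val_eval_sub_le_val_sub {A B C X z : K} (hA : v A ≤ 1) (hB : v B ≤ 1) (hX : v X ≤ 1)
    (hz : v z ≤ 1) :
    v ((z ^ 3 + A * z ^ 2 + B * z + C) - (X ^ 3 + A * X ^ 2 + B * X + C)) ≤ v (z - X) := by
  rw [eval_sub_eval, Valuation.map_mul]
  have h3 : v (3 : K) ≤ 1 := by simpa using valuation_natCast_le_one v 3
  have h2 : v (2 : K) ≤ 1 := by simpa using valuation_natCast_le_one v 2
  have hzX : v (z - X) ≤ 1 := v.map_sub_le hz hX
  have hq : v (3 * X ^ 2 + 2 * A * X + B + (z - X) * (z - X + (3 * X + A))) ≤ 1 := by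
    refine v.map_add_le (v.map_add_le (v.map_add_le ?_ ?_) hB) ?_
    · rw [Valuation.map_mul, Valuation.map_pow]
      exact mul_le_one' h3 (pow_le_one₀ zero_le hX)
    · rw [Valuation.map_mul, Valuation.map_mul]
      exact mul_le_one' (mul_le_one' h2 hA) hX
    · rw [Valuation.map_mul]
      refine mul_le_one' hzX (v.map_add_le hzX (v.map_add_le ?_ hA))
      rw [Valuation.map_mul]; exact mul_le_one' h3 hX
  calc v (z - X) * v (3 * X ^ 2 + 2 * A * X + B + (z - X) * (z - X + (3 * X + A)))
      ≤ v (z - X) * 1 := mul_le_mul_right hq _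
    _ = v (z - X) := mul_one _

/-! ### Newton's iteration for a monic cubic -/

/-- Taylor expansion of the monic cubic at `x`. [folklore] -/
theorem cubic_eval_add (α β γ x h : K) :
    (x + h) ^ 3 + α * (x + h) ^ 2 + β * (x + h) + γ =
      (x ^ 3 + α * x ^ 2 + β * x + γ) + (3 * x ^ 2 + 2 * α * x + β) * h +
        (3 * x + α + h) * h ^ 2 := by
  ring

/-- Taylor expansion of the derivative of the monic cubic at `x`. [folklore] -/
theorem cubic_deriv_add (α β x h : K) :
    3 * (x + h) ^ 2 + 2 * α * (x + h) + β =
      (3 * x ^ 2 + 2 * α * x + β) + h * (6 * x + 2 * α + 3 * h) := by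
  ring

/-- **Newton step.** For `f = X³ + αX² + βX + γ` with `v(α) ≤ 1`, an integral `x` with
`v(f(x)) < 1` and `v(f′(x)) = 1` improves to `y = x − f(x)/f′(x)`: `v(y − x) ≤ v(f(x))`,
`v(f(y)) ≤ v(f(x))²`, `v(f′(y)) = 1`. [cite: NeukirchANT1999, Ch. II (4.6)] -/
theorem newton_step {α β γ x : K} (hα : v α ≤ 1) (hx : v x ≤ 1)
    (hfx : v (x ^ 3 + α * x ^ 2 + β * x + γ) < 1) (hd : v (3 * x ^ 2 + 2 * α * x + β) = 1) :
    ∃ y : K, v y ≤ 1 ∧ v (y - x) ≤ v (x ^ 3 + α * x ^ 2 + β * x + γ) ∧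
      v (y ^ 3 + α * y ^ 2 + β * y + γ) ≤ v (x ^ 3 + α * x ^ 2 + β * x + γ) ^ 2 ∧
      v (3 * y ^ 2 + 2 * α * y + β) = 1 := by
  set f := x ^ 3 + α * x ^ 2 + β * x + γ with hf
  set d := 3 * x ^ 2 + 2 * α * x + β with hdd
  have hd0 : d ≠ 0 := (Valuation.ne_zero_iff v).mp (by rw [hd]; exact one_ne_zero)
  set h := -f / d with hh
  have hvh : v h = v f := by rw [hh, Valuation.map_div, Valuation.map_neg, hd, div_one]
  have h3 : v (3 : K) ≤ 1 := by simpa using valuation_natCast_le_one v 3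
  have h2 : v (2 : K) ≤ 1 := by simpa using valuation_natCast_le_one v 2
  have h6 : v (6 : K) ≤ 1 := by simpa using valuation_natCast_le_one v 6
  have hvh1 : v h ≤ 1 := by rw [hvh]; exact hfx.le
  refine ⟨x + h, (v.map_add x h).trans (max_le hx hvh1), ?_, ?_, ?_⟩
  · rw [add_sub_cancel_left, hvh]
  · rw [cubic_eval_add, ← hf, ← hdd]
    have hcancel : f + d * h = 0 := by rw [hh]; field_simp; ring
    rw [hcancel, zero_add, Valuation.map_mul, Valuation.map_pow, hvh]
    have hc : v (3 * x + α + h) ≤ 1 := by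
      refine v.map_add_le (v.map_add_le ?_ hα) hvh1
      rw [Valuation.map_mul]; exact mul_le_one' h3 hx
    calc v (3 * x + α + h) * v f ^ 2 ≤ 1 * v f ^ 2 := mul_le_mul_left hc _
      _ = v f ^ 2 := one_mul _
  · rw [cubic_deriv_add, ← hdd]
    have hlt : v (h * (6 * x + 2 * α + 3 * h)) < v d := by
      rw [hd, Valuation.map_mul]
      have hc : v (6 * x + 2 * α + 3 * h) ≤ 1 := by
        refine v.map_add_le (v.map_add_le ?_ ?_) ?_
        · rw [Valuation.map_mul]; exact mul_le_one' h6 hx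
        · rw [Valuation.map_mul]; exact mul_le_one' h2 hα
        · rw [Valuation.map_mul]; exact mul_le_one' h3 hvh1
      calc v h * v (6 * x + 2 * α + 3 * h) ≤ v h * 1 := mul_le_mul_right hc _
        _ = v f := by rw [mul_one, hvh]
        _ < 1 := hfx
    rw [v.map_add_eq_of_lt_left hlt, hd]

/-- **Newton iteration.** Under the hypotheses of `newton_step`, for every `n` there is an
integral `y` with `v(f(y)) ≤ v(f(x))^{2ⁿ}` and `v(f′(y)) = 1`.
[cite: NeukirchANT1999, Ch. II (4.6)] -/
theorem newton_iter {α β γ x : K} (hα : v α ≤ 1) (hx : v x ≤ 1)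
    (hfx : v (x ^ 3 + α * x ^ 2 + β * x + γ) < 1) (hd : v (3 * x ^ 2 + 2 * α * x + β) = 1)
    (n : ℕ) :
    ∃ y : K, v y ≤ 1 ∧
      v (y ^ 3 + α * y ^ 2 + β * y + γ) ≤ v (x ^ 3 + α * x ^ 2 + β * x + γ) ^ (2 ^ n) ∧
      v (3 * y ^ 2 + 2 * α * y + β) = 1 := by
  induction n with
  | zero => exact ⟨x, hx, by rw [pow_zero, pow_one], hd⟩
  | succ n ih =>
    obtain ⟨y, hy, hfy, hdy⟩ := ih
    have hfy1 : v (y ^ 3 + α * y ^ 2 + β * y + γ) < 1 :=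
      lt_of_le_of_lt hfy (pow_lt_one₀ zero_le hfx (pow_ne_zero _ two_ne_zero))
    obtain ⟨z, hz, -, hfz, hdz⟩ := newton_step hα hy hfy1 hdy
    refine ⟨z, hz, hfz.trans ?_, hdz⟩
    rw [show 2 ^ (n + 1) = 2 ^ n * 2 from pow_succ 2 n, pow_mul]
    exact pow_le_pow_left₀ zero_le hfy 2

end Generic

/-! ### A simple root modulo `3` -/

/-- **A monic cubic over `𝔽₃` with non-square discriminant has a simple root in `𝔽₃`**
(factorisation type `(1)(2)`): for residues `a, b, c ∈ {0, 1, 2}` with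
`disc(X³ + aX² + bX + c) ≡ 2 (mod 3)` there is `r ∈ {0, 1, 2}` with `3 ∣ g(r)`, `3 ∤ g′(r)`.
By enumeration of the `27` cases. [folklore] -/
theorem exists_simple_root_mod_three {a b c : ℤ} (ha : a = 0 ∨ a = 1 ∨ a = 2)
    (hb : b = 0 ∨ b = 1 ∨ b = 2) (hc : c = 0 ∨ c = 1 ∨ c = 2)
    (hd : (3 : ℤ) ∣ a ^ 2 * b ^ 2 - 4 * b ^ 3 - 4 * a ^ 3 * c - 27 * c ^ 2 + 18 * a * b * c - 2) :
    ∃ r : ℤ, (r = 0 ∨ r = 1 ∨ r = 2) ∧ (3 : ℤ) ∣ r ^ 3 + a * r ^ 2 + b * r + c ∧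
      ¬ (3 : ℤ) ∣ 3 * r ^ 2 + 2 * a * r + b := by
  rcases ha with rfl | rfl | rfl <;> rcases hb with rfl | rfl | rfl <;> rcases hc with rfl | rfl | rfl <;>
    norm_num at hd <;>
    first
    | (refine ⟨0, ?_⟩; norm_num; done)
    | (refine ⟨1, ?_⟩; norm_num; done)
    | (refine ⟨2, ?_⟩; norm_num)

/-! ### Residues modulo the prime over `3` of a `9`-th cyclotomic field -/

section Residue

variable {F : Type} [Field F] [NumberField F] [hF : IsCyclotomicExtension {3 ^ (1 + 1)} ℚ F]
  (w : HeightOneSpectrum (𝓞 F)) (hw : (3 : 𝓞 F) ∈ w.asIdeal)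
include hw

/-- **Residue field `𝔽₃`.** Every `y ∈ 𝓞 F` is congruent to `0`, `1` or `2` modulo the prime
`w ∋ 3`: `y ∉ 𝔭_w` gives `y² − 1 = (y − 1)(y + 1) ∈ 𝔭_w` (`sq_sub_one_mem_of_notMem`), and
`y + 1 ≡ y − 2`. [cite: Washington1997, Lemma 1.4] -/
theorem exists_int_residue (y : 𝓞 F) :
    ∃ n : ℤ, (n = 0 ∨ n = 1 ∨ n = 2) ∧ y - n ∈ w.asIdeal := by
  by_cases hy : y ∈ w.asIdeal
  · exact ⟨0, Or.inl rfl, by simpa using hy⟩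
  have h := sq_sub_one_mem_of_notMem w hw hy
  have hfac : y ^ 2 - 1 = (y - 1) * (y + 1) := by ring
  rw [hfac] at h
  rcases Ideal.IsPrime.mem_or_mem inferInstance h with h1 | h1
  · exact ⟨1, Or.inr (Or.inl rfl), by simpa using h1⟩
  · refine ⟨2, Or.inr (Or.inr rfl), ?_⟩
    have : y - (2 : ℤ) = (y + 1) - 3 := by push_cast; ring
    rw [this]
    exact Ideal.sub_mem _ h1 hw

/-- Valuation form of `exists_int_residue`: `w(y − n) < 1` for some `n ∈ {0, 1, 2}`.
[cite: Washington1997, Lemma 1.4] -/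
theorem exists_int_residue_val (y : 𝓞 F) :
    ∃ n : ℤ, (n = 0 ∨ n = 1 ∨ n = 2) ∧ w.valuation F ((y : F) - n) < 1 := by
  obtain ⟨n, hn, hmem⟩ := exists_int_residue w hw y
  refine ⟨n, hn, ?_⟩
  have e : ((y - n : 𝓞 F) : F) = (y : F) - n := by
    rw [RingOfIntegers.coe_eq_algebraMap, map_sub, map_intCast]
  rw [← e]
  exact (valuation_lt_one_iff_mem w _).mpr hmem

/-- Integers prime to `3` are `w`-units; multiples of `3` lie in `𝔭_w`: `w(n) < 1 ↔ 3 ∣ n`.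
[folklore] -/
theorem val_intCast_lt_one_iff (n : ℤ) : w.valuation F (n : F) < 1 ↔ (3 : ℤ) ∣ n := by
  constructor
  · intro h
    by_contra hnd
    exact absurd ((GNineCriterion.placeData_nine w hw).2.2 n hnd) h.ne
  · rintro ⟨k, rfl⟩
    push_cast
    rw [map_mul, (GNineCriterion.placeData_nine w hw).2.1]
    have hk : w.valuation F (k : F) ≤ 1 := by
      have : (k : F) = algebraMap (𝓞 F) F (k : 𝓞 F) := by simp
      rw [this]; exact valuation_le_one w _
    calc WithZero.exp (-6 : ℤ) * w.valuation F (k : F) ≤ WithZero.exp (-6 : ℤ) * 1 :=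
          mul_le_mul_right hk _
      _ < 1 := by rw [mul_one, ← WithZero.exp_zero, WithZero.exp_lt_exp]; norm_num

end Residue

end Summit.BirchSwinnertonDyer.BirchSwinnertonDyer.Theorems.GNineConverse
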